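import Summits.CriticalPhenomena.CardyFormulaZ2.Theorems.CardyIKTransportIKLinearTransportTwoCutDefs

/-!
# Stub `stub_TwoCutComb` — part 1: no-crossing at a cut row, bichromatic flags, and the two-cut
# characterisation (C)

Support file (`--supports stmt-CriticalPhenomena-5076`, registered sub-goal `tc_twoCut_iff`).

Two-cut combinatorics of the 3-column strip (cell columns `i, i+1, i+2`) for the two-sided cut-Markov kernel:

* `tc_noCrossUp` / `tc_noCrossDown` — NO CROSSING: if the row-`e` boundary cells carry one colour, the middle cell
  the other, and the two boundary cells are not joined inside the rows `≥ e` (resp. `≤ e`), then a monochromatic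
  path inside any part `s` of a colour class between two cells of rows `≤ e` (resp. `≥ e`) is rerouted INSIDE `s` to
  stay in the rows `≤ e` (resp. `≥ e`) (the abstract rerouting `crk_reroute_abstract` with the row-`e` separation);
* `tc_reach_flat` — under the boundary pattern and the middle colour `¬col` on the rows `c, c+1`, reachability inside
  any part of a colour class does not read the row-`c` flags (the two faces are bichromatic), whence (E)
  `tc_RW_flat : IsCut i c → cmkRW i c c' (cmkFlat i c x) = cmkRW i c c' x`;
* `tc_isCut_pivQ_down` — the mirror of `cmk_isCut_pivQ`;
* `tc_twoCut_iff` (registered) — (C): for `c ≤ -1`, `1 ≤ c'`,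
  `IsCut c ∧ IsCut c' ↔ TcLow c ∧ TcWin c c' ∧ TcHigh c'`.
-/

noncomputable section

namespace Summit.CriticalPhenomena.CardyFormulaZ2.Theorems.IKLinearTransport.PinnedDiagramExchange

open scoped Classical MeasureTheory ENNReal symmDiff
open Set MeasureTheory
open Literature.Probability.Percolation Literature.Probability.LatticeModels

/-! ## Window reachability -/

/-- Window reachability through `within` on the colour class cut to the rows `[lo, hi]`. [folklore] -/
theorem tc_mem_RW_iff (i lo hi : ℤ) (x : Obs) (p q : Site 2) :
    (p, q) ∈ cmkRW i lo hi x ↔ (q ∈ SDE.cls x i p ∧ lo ≤ q 1 ∧ q 1 ≤ hi) ∧ (p ∈ SDE.cls x i p ∧ lo ≤ p 1 ∧ p 1 ≤ hi) ∧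
      (SDE.within (cellGraph x.2) (SDE.cls x i p ∩ {v | lo ≤ v 1 ∧ v 1 ≤ hi})).Reachable p q :=
  Iff.rfl

/-- Window reachability lies in the upper half-strip reachability of its bottom row. [folklore] -/
theorem tc_RW_sub_UpR (i : ℤ) {c c' : ℤ} (h : c ≤ c') (x : Obs) : cmkRW i c c' x ⊆ cmkUpR i c x := fun _ hpq =>
  ⟨(c' - c).toNat, by rwa [show c + ((c' - c).toNat : ℤ) = c' by omega]⟩

/-- Window reachability lies in the lower half-strip reachability of its top row. [folklore] -/
theorem tc_RW_sub_LoR (i : ℤ) {c c' : ℤ} (h : c ≤ c') (x : Obs) : cmkRW i c c' x ⊆ cmkLoR i c' x := fun _ hpq =>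
  ⟨(c' - c).toNat, by rwa [show c' - ((c' - c).toNat : ℤ) = c by omega]⟩

/-- Upper half-strip reachability is antitone in the row. [folklore] -/
theorem tc_UpR_anti (i : ℤ) {c c' : ℤ} (h : c ≤ c') (x : Obs) : cmkUpR i c' x ⊆ cmkUpR i c x := by
  rintro ⟨p, q⟩ hpq
  rw [cmk_mem_UpR_iff] at hpq ⊢
  obtain ⟨⟨hq, hq1⟩, ⟨hp, hp1⟩, hr⟩ := hpq
  have hsub : SDE.cls x i p ∩ {v | c' ≤ v 1} ⊆ SDE.cls x i p ∩ {v | c ≤ v 1} := fun v hv =>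
    ⟨hv.1, by have hv2 : c' ≤ v 1 := hv.2; show c ≤ v 1; omega⟩
  exact ⟨⟨hq, by omega⟩, ⟨hp, by omega⟩, SDE.within_mono _ hsub hr⟩

/-- Window reachability is symmetric. [folklore] -/
theorem tc_RW_symm {i lo hi : ℤ} {x : Obs} {p q : Site 2} (h : (p, q) ∈ cmkRW i lo hi x) : (q, p) ∈ cmkRW i lo hi x := by
  rw [tc_mem_RW_iff] at h ⊢
  obtain ⟨⟨hq, hq1⟩, ⟨hp, hp1⟩, hr⟩ := h
  have e := cmk_cls_eq_of_mem hq
  refine ⟨⟨by rw [e]; exact hp, hp1⟩, ⟨⟨Iff.rfl, hq.2⟩, hq1⟩, ?_⟩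
  rw [e]; exact hr.symm

/-- The diagonal of window reachability. [folklore] -/
theorem tc_RW_refl {i lo hi : ℤ} (x : Obs) {P : Site 2} (h0 : i ≤ P 0) (h0' : P 0 ≤ i + 2) (h1 : lo ≤ P 1)
    (h1' : P 1 ≤ hi) : (P, P) ∈ cmkRW i lo hi x :=
  (tc_mem_RW_iff _ _ _ _ _ _).2 ⟨⟨⟨Iff.rfl, h0, h0'⟩, h1, h1'⟩, ⟨⟨Iff.rfl, h0, h0'⟩, h1, h1'⟩, SimpleGraph.Reachable.refl _⟩

/-- Regrouping of the row constraints (window from below). [folklore] -/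
theorem tc_sub_up (s : Set (Site 2)) (lo hi : ℤ) :
    s ∩ {v | lo ≤ v 1} ∩ {w | w 1 ≤ hi} ⊆ s ∩ {v | lo ≤ v 1 ∧ v 1 ≤ hi} := fun _ hv => ⟨hv.1.1, hv.1.2, hv.2⟩

/-- Regrouping of the row constraints (window from above). [folklore] -/
theorem tc_sub_down (s : Set (Site 2)) (lo hi : ℤ) :
    s ∩ {v | v 1 ≤ hi} ∩ {w | lo ≤ w 1} ⊆ s ∩ {v | lo ≤ v 1 ∧ v 1 ≤ hi} := fun _ hv => ⟨hv.1.1, hv.2, hv.1.2⟩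

/-- Dropping the middle constraint. [folklore] -/
theorem tc_sub_right (s A B : Set (Site 2)) : s ∩ A ∩ B ⊆ s ∩ B := fun _ hv => ⟨hv.1.1, hv.2⟩

/-! ## No crossing at a separating row -/

/-- ROW SEPARATION ABOVE: if the right boundary cell of row `e` has the colour of the left one, the middle cell the
other colour, and the two boundary cells are not joined inside the rows `≥ e`, then two row-`e` cells of a part `s` of
a colour class joined inside `s ∩ {rows ≥ e}` coincide. [folklore] -/
theorem tc_rowsep_up {i e : ℤ} {x : Obs} (hR : (![i + 2, e] : Site 2) ∈ x.1 ↔ (![i, e] : Site 2) ∈ x.1)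
    (hM : (![i + 1, e] : Site 2) ∈ x.1 ↔ (![i, e] : Site 2) ∉ x.1)
    (hn : ((![i, e], ![i + 2, e]) : Site 2 × Site 2) ∉ cmkUpR i e x) {p : Site 2} {s : Set (Site 2)}
    (hs : s ⊆ SDE.cls x i p) (X Y : Site 2) (hX : X ∈ s) (hY : Y ∈ s) (hXe : X 1 = e) (hYe : Y 1 = e)
    (h : (SDE.within (cellGraph x.2) (s ∩ {v | e ≤ v 1})).Reachable X Y) : X = Y := by
  have hXc := hs hX
  have hYc := hs hY
  have hcol : X ∈ x.1 ↔ Y ∈ x.1 := hXc.1.trans hYc.1.symm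
  have hup : (X, Y) ∈ cmkUpR i e x := by
    rw [cmk_mem_UpR_iff, cmk_cls_eq_of_mem hXc]
    exact ⟨⟨hYc, hYe.ge⟩, ⟨hXc, hXe.ge⟩, SDE.within_mono _ (inter_subset_inter_left _ hs) h⟩
  rcases cmk_rowc_cases hXc.2.1 hXc.2.2 hXe with rfl | rfl | rfl <;>
    rcases cmk_rowc_cases hYc.2.1 hYc.2.2 hYe with rfl | rfl | rfl
  · rfl
  · exact (iff_not_self (hcol.trans hM)).elim
  · exact (hn hup).elim
  · exact (iff_not_self (hcol.symm.trans hM)).elim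
  · rfl
  · exact (iff_not_self ((hcol.trans hR).symm.trans hM)).elim
  · exact (hn (cmk_UpR_symm hup)).elim
  · exact (iff_not_self ((hR.symm.trans hcol).trans hM)).elim
  · rfl

/-- ROW SEPARATION BELOW (the mirror image). [folklore] -/
theorem tc_rowsep_down {i e : ℤ} {x : Obs} (hR : (![i + 2, e] : Site 2) ∈ x.1 ↔ (![i, e] : Site 2) ∈ x.1)
    (hM : (![i + 1, e] : Site 2) ∈ x.1 ↔ (![i, e] : Site 2) ∉ x.1)
    (hn : ((![i, e], ![i + 2, e]) : Site 2 × Site 2) ∉ cmkLoR i e x) {p : Site 2} {s : Set (Site 2)}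
    (hs : s ⊆ SDE.cls x i p) (X Y : Site 2) (hX : X ∈ s) (hY : Y ∈ s) (hXe : X 1 = e) (hYe : Y 1 = e)
    (h : (SDE.within (cellGraph x.2) (s ∩ {v | v 1 ≤ e})).Reachable X Y) : X = Y := by
  have hXc := hs hX
  have hYc := hs hY
  have hcol : X ∈ x.1 ↔ Y ∈ x.1 := hXc.1.trans hYc.1.symm
  have hlo : (X, Y) ∈ cmkLoR i e x := by
    rw [cmk_mem_LoR_iff, cmk_cls_eq_of_mem hXc]
    exact ⟨⟨hYc, hYe.le⟩, ⟨hXc, hXe.le⟩, SDE.within_mono _ (inter_subset_inter_left _ hs) h⟩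
  rcases cmk_rowc_cases hXc.2.1 hXc.2.2 hXe with rfl | rfl | rfl <;>
    rcases cmk_rowc_cases hYc.2.1 hYc.2.2 hYe with rfl | rfl | rfl
  · rfl
  · exact (iff_not_self (hcol.trans hM)).elim
  · exact (hn hlo).elim
  · exact (iff_not_self (hcol.symm.trans hM)).elim
  · rfl
  · exact (iff_not_self ((hcol.trans hR).symm.trans hM)).elim
  · exact (hn (cmk_LoR_symm hlo)).elim
  · exact (iff_not_self ((hR.symm.trans hcol).trans hM)).elim
  · rfl

/-- NO CROSSING UPWARDS: under the separation above row `e`, a path inside a part `s` of a colour class between two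
cells of rows `≤ e` is rerouted inside `s` to stay in the rows `≤ e`. [folklore] -/
theorem tc_noCrossUp {i e : ℤ} {x : Obs} (hR : (![i + 2, e] : Site 2) ∈ x.1 ↔ (![i, e] : Site 2) ∈ x.1)
    (hM : (![i + 1, e] : Site 2) ∈ x.1 ↔ (![i, e] : Site 2) ∉ x.1)
    (hn : ((![i, e], ![i + 2, e]) : Site 2 × Site 2) ∉ cmkUpR i e x) {p : Site 2} {s : Set (Site 2)} {u v : Site 2}
    (h : (SDE.within (cellGraph x.2) s).Reachable u v) (hs : s ⊆ SDE.cls x i p) (hu : u ∈ s) (hue : u 1 ≤ e)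
    (hve : v 1 ≤ e) : (SDE.within (cellGraph x.2) (s ∩ {w | w 1 ≤ e})).Reachable u v :=
  crk_reroute_abstract_lower (cellGraph x.2) (fun w => w 1) (fun _ _ hab => ⟨(crk_adj_near hab).1, (crk_adj_near hab).2.1⟩)
    s e (fun X Y hX hY hXe hYe hr => tc_rowsep_up hR hM hn hs X Y hX hY hXe hYe hr)
    ⟨hu, hue⟩ ⟨SDE.within_reachable_mem _ _ h hu, hve⟩ h

/-- NO CROSSING DOWNWARDS: under the separation below row `e`, a path inside a part `s` of a colour class between two
cells of rows `≥ e` is rerouted inside `s` to stay in the rows `≥ e`. [folklore] -/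
theorem tc_noCrossDown {i e : ℤ} {x : Obs} (hR : (![i + 2, e] : Site 2) ∈ x.1 ↔ (![i, e] : Site 2) ∈ x.1)
    (hM : (![i + 1, e] : Site 2) ∈ x.1 ↔ (![i, e] : Site 2) ∉ x.1)
    (hn : ((![i, e], ![i + 2, e]) : Site 2 × Site 2) ∉ cmkLoR i e x) {p : Site 2} {s : Set (Site 2)} {u v : Site 2}
    (h : (SDE.within (cellGraph x.2) s).Reachable u v) (hs : s ⊆ SDE.cls x i p) (hu : u ∈ s) (hue : e ≤ u 1)
    (hve : e ≤ v 1) : (SDE.within (cellGraph x.2) (s ∩ {w | e ≤ w 1})).Reachable u v :=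
  crk_reroute_abstract (cellGraph x.2) (fun w => w 1) (fun _ _ hab => ⟨(crk_adj_near hab).1, (crk_adj_near hab).2.1⟩) s e
    (fun X Y hX hY hXe hYe hr => tc_rowsep_down hR hM hn hs X Y hX hY hXe hYe hr)
    ⟨hu, hue⟩ ⟨SDE.within_reachable_mem _ _ h hu, hve⟩ h

/-! ## The separation data of a cut row -/

section Cut

variable {i c : ℤ} {x : Obs}

/-- At a cut row: right boundary colour `col`, middle colours `¬col` on the rows `c, c+1`, and the two boundary
cells joined neither above nor below. [folklore] -/
theorem tc_cut_sep (h : IsCut i c (pinnedStat i x)) :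
    ((![i + 2, c] : Site 2) ∈ x.1 ↔ (![i, c] : Site 2) ∈ x.1) ∧ ((![i + 1, c] : Site 2) ∈ x.1 ↔ (![i, c] : Site 2) ∉ x.1) ∧
    ((![i + 1, c + 1] : Site 2) ∈ x.1 ↔ (![i, c] : Site 2) ∉ x.1) ∧
    ((![i, c], ![i + 2, c]) : Site 2 × Site 2) ∉ cmkUpR i c x ∧ ((![i, c], ![i + 2, c]) : Site 2 × Site 2) ∉ cmkLoR i c x := by
  obtain ⟨hpat, hnL, -, hnU, -⟩ := cmk_isCut_imp_cutLoc h
  rw [cmk_isCut_UpR_flat h] at hnU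
  exact ⟨(hpat.1 c (by omega) (by omega)).2, isCut_forces_mid i c x h c (by omega) (by omega),
    isCut_forces_mid i c x h (c + 1) (by omega) (by omega), hnU, hnL⟩

/-- No crossing upwards at a cut row. [folklore] -/
theorem tc_cut_noCrossUp (h : IsCut i c (pinnedStat i x)) {p : Site 2} {s : Set (Site 2)} {u v : Site 2}
    (hr : (SDE.within (cellGraph x.2) s).Reachable u v) (hs : s ⊆ SDE.cls x i p) (hu : u ∈ s) (hue : u 1 ≤ c)
    (hve : v 1 ≤ c) : (SDE.within (cellGraph x.2) (s ∩ {w | w 1 ≤ c})).Reachable u v :=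
  tc_noCrossUp (tc_cut_sep h).1 (tc_cut_sep h).2.1 (tc_cut_sep h).2.2.2.1 hr hs hu hue hve

/-- No crossing downwards at a cut row. [folklore] -/
theorem tc_cut_noCrossDown (h : IsCut i c (pinnedStat i x)) {p : Site 2} {s : Set (Site 2)} {u v : Site 2}
    (hr : (SDE.within (cellGraph x.2) s).Reachable u v) (hs : s ⊆ SDE.cls x i p) (hu : u ∈ s) (hue : c ≤ u 1)
    (hve : c ≤ v 1) : (SDE.within (cellGraph x.2) (s ∩ {w | c ≤ w 1})).Reachable u v :=
  tc_noCrossDown (tc_cut_sep h).1 (tc_cut_sep h).2.1 (tc_cut_sep h).2.2.2.2 hr hs hu hue hve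

end Cut

/-! ## Bichromatic row-`c` faces: the flags of row `c` do not matter -/

/-- Under the boundary pattern at `c` and the middle colour `¬col` on the rows `c, c+1`, reachability inside any part
of a colour class does not read the row-`c` flags. [folklore] -/
theorem tc_reach_flat {i c : ℤ} {x : Obs} (hpat : cmkPattern i c x)
    (hm0 : (![i + 1, c] : Site 2) ∈ x.1 ↔ (![i, c] : Site 2) ∉ x.1)
    (hm1 : (![i + 1, c + 1] : Site 2) ∈ x.1 ↔ (![i, c] : Site 2) ∉ x.1) {p : Site 2} {s : Set (Site 2)}
    (hs : s ⊆ SDE.cls x i p) (u v : Site 2) :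
    (SDE.within (cellGraph (cmkFlat i c x).2) s).Reachable u v ↔ (SDE.within (cellGraph x.2) s).Reachable u v := by
  obtain ⟨hbd, -, -⟩ := hpat
  have hL0 := (hbd c (by omega) (by omega)).1
  have hL1 := (hbd (c + 1) (by omega) (by omega)).1
  have hR0 := (hbd c (by omega) (by omega)).2
  have hR1 := (hbd (c + 1) (by omega) (by omega)).2
  refine cmk_reach_congr_of_bichromatic (fun a b => ?_) u v
  by_cases hab : (a = i ∧ b = c) ∨ (a = i + 1 ∧ b = c)
  · right
    have clash : ∀ {P Q : Site 2}, (P ∈ x.1 ↔ (![i, c] : Site 2) ∈ x.1) → (Q ∈ x.1 ↔ (![i, c] : Site 2) ∉ x.1) →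
        ¬ (P ∈ s ∧ Q ∈ s) := by
      rintro P Q hP hQ ⟨hP', hQ'⟩
      exact iff_not_self ((hP.symm.trans ((hs hP').1.trans (hs hQ').1.symm)).trans hQ)
    have clash' : ∀ {P Q : Site 2}, (P ∈ x.1 ↔ (![i, c] : Site 2) ∉ x.1) → (Q ∈ x.1 ↔ (![i, c] : Site 2) ∈ x.1) →
        ¬ (P ∈ s ∧ Q ∈ s) := fun hP hQ h => clash hQ hP ⟨h.2, h.1⟩
    rcases hab with ⟨ha, hb⟩ | ⟨ha, hb⟩
    · rw [ha, hb]; exact ⟨clash hL0 hm1, clash hL1 hm0⟩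
    · rw [ha, hb, show (i + 1 + 1 : ℤ) = i + 2 by ring]; exact ⟨clash' hm0 hR1, clash' hm1 hR0⟩
  · left
    simp only [cmkFlat, mem_setOf_eq, SquareTiling.vec2_eq_iff]
    tauto

/-- … hence window reachability does not read the row-`c` flags. [folklore] -/
theorem tc_RW_flat_of {i c : ℤ} {x : Obs} (hpat : cmkPattern i c x)
    (hm0 : (![i + 1, c] : Site 2) ∈ x.1 ↔ (![i, c] : Site 2) ∉ x.1)
    (hm1 : (![i + 1, c + 1] : Site 2) ∈ x.1 ↔ (![i, c] : Site 2) ∉ x.1) (lo hi : ℤ) :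
    cmkRW i lo hi (cmkFlat i c x) = cmkRW i lo hi x := by
  ext ⟨p, q⟩
  rw [tc_mem_RW_iff, tc_mem_RW_iff, cmk_cls_flat, tc_reach_flat hpat hm0 hm1 inter_subset_left]

/-- (E) AT A CUT ROW THE ROW-`c` FLAGS ARE IRRELEVANT TO WINDOW REACHABILITY. [folklore] -/
theorem tc_RW_flat (i c lo hi : ℤ) (x : Obs) (h : IsCut i c (pinnedStat i x)) : cmkRW i lo hi (cmkFlat i c x) = cmkRW i lo hi x :=
  tc_RW_flat_of ((cmk_isCut_iff_pattern i c x).1 h).1 (tc_cut_sep h).2.1 (tc_cut_sep h).2.2.1 lo hi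

/-! ## The pivot joined below -/

/-- At a cut row, the pivot is joined BELOW to a boundary cell `Q` iff `((i, c+2), Q)` is in the strip diagram (the
mirror image of `cmk_isCut_pivQ`). [folklore] -/
theorem tc_isCut_pivQ_down {i c : ℤ} {x : Obs} (h : IsCut i c (pinnedStat i x)) {Q : Site 2} (hQ : cmkBd i Q) :
    ((![i + 1, c] : Site 2), Q) ∈ cmkLoR i c x ↔ Q 1 ≤ c ∧ ((![i, c + 2] : Site 2), Q) ∈ stripDiagram i x := by
  obtain ⟨hpat, -, -⟩ := (cmk_isCut_iff_pattern i c x).1 h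
  obtain ⟨-, hpup⟩ := cmk_isCut_piv h
  obtain ⟨⟨htop, -⟩, -, hr1⟩ := (cmk_mem_UpR_iff _ _ _ _ _).1 hpup
  have e := cmk_cls_eq_of_mem htop
  constructor
  · intro hL
    obtain ⟨⟨hq, hqc⟩, -, hr2⟩ := (cmk_mem_LoR_iff _ _ _ _ _).1 hL
    refine ⟨hqc, ?_⟩
    have hq' : Q ∈ SDE.cls x i ![i, c + 2] := by rw [e]; exact hq
    exact cmk_mem_stripDiagram_of_within (Or.inl (by simp)) hQ hq'
      (show SDE.cls x i ![i + 1, c] ⊆ SDE.cls x i ![i, c + 2] by rw [e])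
      ((SDE.within_mono _ inter_subset_left hr1).symm.trans (SDE.within_mono _ inter_subset_left hr2))
  · rintro ⟨hqc, hD⟩
    rw [SDE.mem_stripDiagram_iff] at hD
    obtain ⟨-, -, hq, hp, hr⟩ := hD
    obtain ⟨w, hw1, hw2, hw3⟩ := cmk_exists_row_split' _ (fun v : Site 2 => v 1)
      (fun u v huv => (cmk_within_rows _ _ u v huv).2) hr c (by simp only [Matrix.cons_val_one, Matrix.cons_val_zero]; omega) hqc
    have hw : w ∈ SDE.cls x i ![i, c + 2] := SDE.within_reachable_mem _ _ hw1 hp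
    have e2 : SDE.cls x i ![i, c + 2] = SDE.cls x i ![i, c - 2] := by
      ext v; simp only [SDE.cls, mem_setOf_eq, hpat.2.1, hpat.2.2]
    have hwp : w = ![i + 1, c] := cmk_rowc_eq_piv hpat (by rw [← e2]; exact hw) hw3
    subst hwp
    rw [cmk_mem_LoR_iff, ← e]
    exact ⟨⟨hq, hqc⟩, ⟨hw, by simp only [Matrix.cons_val_one, Matrix.cons_val_zero]; omega⟩, (isCut_reroute i c x h _ _ _ hw hq hw2).2
      (by simp only [Matrix.cons_val_one, Matrix.cons_val_zero]; omega) hqc⟩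

/-! ## (C) The two-cut characterisation -/

/-- (C), forward: two cut rows give the lower, window and upper conditions. [folklore] -/
theorem tc_twoCut_imp {i c c' : ℤ} {x : Obs} (hc : c ≤ -1) (hc' : 1 ≤ c') (h1 : IsCut i c (pinnedStat i x))
    (h2 : IsCut i c' (pinnedStat i x)) : TcLow i c x ∧ TcWin i c c' x ∧ TcHigh i c' x := by
  obtain ⟨hpat, hnL, hpL, hnU, -⟩ := cmk_isCut_imp_cutLoc h1
  obtain ⟨hpat', -, -, hnU', hpU'⟩ := cmk_isCut_imp_cutLoc h2
  refine ⟨⟨hpat, hnL, hpL⟩, ?_, ⟨hpat', hnU', hpU'⟩⟩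
  have hcc' : c ≤ c' := by omega
  rw [TcWin, tc_RW_flat i c c c' x h1]
  rw [cmk_isCut_UpR_flat h1] at hnU
  refine ⟨fun hW => hnU (tc_RW_sub_UpR i hcc' x hW), ?_, fun hW => ?_, ?_⟩
  · -- the upper pivot path of the cut `c` stays below the cut `c'`
    obtain ⟨-, hup⟩ := cmk_isCut_piv h1
    obtain ⟨⟨hq, -⟩, ⟨hp, hpc⟩, hr⟩ := (cmk_mem_UpR_iff _ _ _ _ _).1 hup
    have hr' := tc_cut_noCrossUp h2 hr inter_subset_left ⟨hp, hpc⟩ (by simp only [Matrix.cons_val_one, Matrix.cons_val_zero]; omega)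
      (by simp only [Matrix.cons_val_one, Matrix.cons_val_zero]; omega)
    rw [tc_mem_RW_iff]
    exact ⟨⟨hq, by simp only [Matrix.cons_val_one, Matrix.cons_val_zero]; omega, by simp only [Matrix.cons_val_one, Matrix.cons_val_zero]; omega⟩, ⟨hp, hpc, by simp only [Matrix.cons_val_one, Matrix.cons_val_zero]; omega⟩,
      SDE.within_mono _ (tc_sub_up _ _ _) hr'⟩
  · -- `(i,c') ≁ (i+2,c')` in the strip
    obtain ⟨-, hnot', -⟩ := (cmk_isCut_iff_pattern i c' x).1 h2
    rw [tc_mem_RW_iff] at hW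
    obtain ⟨⟨hq, -⟩, -, hr⟩ := hW
    exact hnot' (cmk_mem_stripDiagram_of_within (Or.inl (by simp)) (Or.inr (by simp)) hq inter_subset_left hr)
  · -- the lower pivot path of the cut `c'` stays above the cut `c`
    obtain ⟨hlo, -⟩ := cmk_isCut_piv h2
    obtain ⟨⟨hq, hqc⟩, ⟨hp, hpc⟩, hr⟩ := (cmk_mem_LoR_iff _ _ _ _ _).1 hlo
    have hr' := tc_cut_noCrossDown h1 hr inter_subset_left ⟨hp, hpc⟩ (by simp only [Matrix.cons_val_one, Matrix.cons_val_zero]; omega)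
      (by simp only [Matrix.cons_val_one, Matrix.cons_val_zero]; omega)
    rw [tc_mem_RW_iff]
    exact ⟨⟨hq, by simp only [Matrix.cons_val_one, Matrix.cons_val_zero]; omega, hqc⟩, ⟨hp, by simp only [Matrix.cons_val_one, Matrix.cons_val_zero]; omega, hpc⟩,
      SDE.within_mono _ (tc_sub_down _ _ _) hr'⟩

/-- (C), backward: the lower, window and upper conditions give the two cut rows. [folklore] -/
theorem tc_twoCut_of {i c c' : ℤ} {x : Obs} (hc : c ≤ -1) (hc' : 1 ≤ c') (hL : TcLow i c x) (hW : TcWin i c c' x)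
    (hH : TcHigh i c' x) : IsCut i c (pinnedStat i x) ∧ IsCut i c' (pinnedStat i x) := by
  obtain ⟨hpat, hnL, hpL⟩ := hL
  obtain ⟨hpat', hnU', hpU'⟩ := hH
  obtain ⟨hW1, hW2, hW3, hW4⟩ := hW
  have hcc' : c ≤ c' := by omega
  -- middle colours at `c`: the pivot has the colour of `(i, c-2)`; the first step of the upper pivot path
  have hpivc : (![i + 1, c] : Site 2) ∈ SDE.cls x i ![i, c - 2] := ((cmk_mem_LoR_iff _ _ _ _ _).1 hpL).1.1
  have hm0 : (![i + 1, c] : Site 2) ∈ x.1 ↔ (![i, c] : Site 2) ∉ x.1 := hpivc.1.trans hpat.2.1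
  have hm1 := cmk_flat_forces_up hpat hm0 (tc_RW_sub_UpR i hcc' _ hW2)
  rw [tc_RW_flat_of hpat hm0 hm1] at hW1 hW2 hW3 hW4
  -- middle colours at `c'`: `(i, c'+2)` has the colour of the pivot
  have htop : (![i, c' + 2] : Site 2) ∈ SDE.cls x i ![i + 1, c'] := ((cmk_mem_UpR_iff _ _ _ _ _).1 hpU').1.1
  have hm0' : (![i + 1, c'] : Site 2) ∈ x.1 ↔ (![i, c'] : Site 2) ∉ x.1 := htop.1.symm.trans hpat'.2.2
  have hm1' := cmk_flat_forces_up hpat' hm0' hpU'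
  have hnUx : ((![i, c'], ![i + 2, c']) : Site 2 × Site 2) ∉ cmkUpR i c' x := by
    rw [← cmk_UpR_flat hpat' hm0' hm1']; exact hnU'
  constructor
  · refine cmk_cutLoc_imp_isCut ⟨hpat, hnL, hpL, ?_, ?_⟩
    · rw [cmk_UpR_flat hpat hm0 hm1]
      intro hU
      obtain ⟨⟨hq, -⟩, ⟨hp, hpc⟩, hr⟩ := (cmk_mem_UpR_iff _ _ _ _ _).1 hU
      have hr' := tc_noCrossUp (hpat'.1 c' (by omega) (by omega)).2 hm0' hnUx hr inter_subset_left ⟨hp, hpc⟩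
        (by simp only [Matrix.cons_val_one, Matrix.cons_val_zero]; omega) (by simp only [Matrix.cons_val_one, Matrix.cons_val_zero]; omega)
      refine hW1 ((tc_mem_RW_iff _ _ _ _ _ _).2 ⟨⟨hq, by simp only [Matrix.cons_val_one, Matrix.cons_val_zero]; omega, by simp only [Matrix.cons_val_one, Matrix.cons_val_zero]; omega⟩,
        ⟨hp, hpc, by simp only [Matrix.cons_val_one, Matrix.cons_val_zero]; omega⟩, SDE.within_mono _ (tc_sub_up _ _ _) hr'⟩)
    · rw [cmk_UpR_flat hpat hm0 hm1]; exact tc_RW_sub_UpR i hcc' _ hW2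
  · refine cmk_cutLoc_imp_isCut ⟨hpat', ?_, tc_RW_sub_LoR i hcc' _ hW4, hnU', hpU'⟩
    intro hLo
    obtain ⟨⟨hq, hqc⟩, ⟨hp, hpc⟩, hr⟩ := (cmk_mem_LoR_iff _ _ _ _ _).1 hLo
    have hr' := tc_noCrossDown (hpat.1 c (by omega) (by omega)).2 hm0 hnL hr inter_subset_left ⟨hp, hpc⟩
      (by simp only [Matrix.cons_val_one, Matrix.cons_val_zero]; omega) (by simp only [Matrix.cons_val_one, Matrix.cons_val_zero]; omega)
    exact hW3 ((tc_mem_RW_iff _ _ _ _ _ _).2 ⟨⟨hq, by simp only [Matrix.cons_val_one, Matrix.cons_val_zero]; omega, hqc⟩,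
      ⟨hp, by simp only [Matrix.cons_val_one, Matrix.cons_val_zero]; omega, hpc⟩, SDE.within_mono _ (tc_sub_down _ _ _) hr'⟩)

/-- (C) THE TWO-CUT CHARACTERISATION (registered sub-goal `tc_twoCut_iff`): for `c ≤ -1` and `1 ≤ c'`, the rows
`c, c'` are both cut rows of the pinned statistic iff the lower conditions at `c`, the window conditions of `(c, c')`
and the upper conditions at `c'` hold. [folklore] -/
theorem tc_twoCut_iff : ∀ (i c c' : ℤ) (x : Obs), c ≤ -1 → 1 ≤ c' → (IsCut i c (pinnedStat i x) ∧ IsCut i c' (pinnedStat i x) ↔ TcLow i c x ∧ TcWin i c c' x ∧ TcHigh i c' x) :=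
  fun _ _ _ _ hc hc' => ⟨fun h => tc_twoCut_imp hc hc' h.1 h.2, fun h => tc_twoCut_of hc hc' h.1 h.2.1 h.2.2⟩

end Summit.CriticalPhenomena.CardyFormulaZ2.Theorems.IKLinearTransport.PinnedDiagramExchange
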